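import Literature.AlgebraicGeometry.Resolution.CoefficientRingsUnequal
import Literature.RingTheory.CompleteLocalRings.CohenRing
import Literature.RingTheory.CompleteLocalRings.CoefficientField
import Mathlib.RingTheory.Flat.TorsionFree
import HarnessLib

/-!
# A complete DVR (or the residue field) mapping onto the residue field of a complete local ring

`Literature/RingTheory/CompleteLocalRings/CoefficientDVR.lean`. The coefficient data in Kato's
structure theorem for log regular local rings (K. Kato, *Toric singularities*, Amer. J. Math. 116
(1994), Thm. (3.2)): "(1) Assume `𝒪` contains a field and take a subfield `k` of `𝒪̂` with
`k ≅ 𝒪̂/𝔪` … (2) Assume `𝒪` does not contain a field. Take a complete discrete valuation ring `R`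
in which `p = char(𝒪/𝔪)` is a prime element, and a homomorphism `R → 𝒪̂` which induces
`R/pR ≅ 𝒪̂/𝔪`" — i.e. Cohen's theorems (Matsumura, *Commutative Ring Theory*, Thm. 28.3 (ii),
Thms. 29.1–29.2). PROVED here from the tree's Cohen machinery
(`Literature.RingTheory.CompleteLocalRings.{CohenRing, PRingLifting, CoefficientField}`,
`Literature.AlgebraicGeometry.Resolution.CoefficientRingsUnequal`), for a complete Noetherian
local ring `C` with residue field `k`:

* `exists_cohenDVR_ringHom` (`char k = p > 0`): a complete Noetherian local DOMAIN `R` with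
  maximal ideal `pR ≠ 0` (a complete DVR with prime element `p`) and a ring homomorphism
  `j : R → C` inducing a surjection (indeed an isomorphism) on residue fields;
* `exists_coefficientField_of_charZero` (`char k = 0`): a coefficient field, i.e. a section
  `σ : k → C` of the residue map (here `C ⊇ ℚ` automatically).

References: [Kato1994] K. Kato, Toric singularities, Amer. J. Math. 116 (1994), (3.2);
[Matsumura1987] H. Matsumura, Commutative Ring Theory, Thms. 28.3, 29.1, 29.2.
-/

noncomputable section

open IsLocalRing

namespace Literature.RingTheory.CompleteLocalRings

universe u

/-! ### A complete `p`-ring with `p` a non-zero-divisor is a domain, and is `ℤ`-flat -/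

section PRing

variable {R : Type u} [CommRing R] [IsLocalRing R] [IsNoetherianRing R] (p : ℕ) [Fact p.Prime]

omit [Fact p.Prime] in
/-- In a Noetherian local ring with maximal ideal `pR` on which `p` is a non-zero-divisor, every
non-zero element is `pᵃ · u` with `u` a unit (Krull's intersection theorem).
[cite: Matsumura1987, §29 pp. 223–225] -/
theorem exists_eq_pow_mul_unit_of_pRing (hmax : maximalIdeal R = Ideal.span {(p : R)})
    {x : R} (hx : x ≠ 0) : ∃ (a : ℕ) (u : R), IsUnit u ∧ x = (p : R) ^ a * u := by
  classical
  -- `x ∉ ⋂ₙ pⁿR = 0`, so there is a largest `a` with `x ∈ pᵃR`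
  have hinf : (⨅ n : ℕ, maximalIdeal R ^ n) = ⊥ :=
    Ideal.iInf_pow_eq_bot_of_isLocalRing _ (maximalIdeal.isMaximal R).ne_top
  have hnot : ∃ n : ℕ, x ∉ maximalIdeal R ^ n := by
    by_contra hcon
    push Not at hcon
    exact hx (by rw [← Ideal.mem_bot, ← hinf]; exact Ideal.mem_iInf.2 hcon)
  let n₀ := Nat.find hnot
  have hn₀ : x ∉ maximalIdeal R ^ n₀ := Nat.find_spec hnot
  have hpos : n₀ ≠ 0 := by
    intro h0
    apply hn₀
    rw [h0, pow_zero, Ideal.one_eq_top]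
    exact Submodule.mem_top
  obtain ⟨a, ha⟩ := Nat.exists_eq_succ_of_ne_zero hpos
  have hxa : x ∈ maximalIdeal R ^ a := by
    have := Nat.find_min hnot (show a < n₀ by omega)
    push Not at this
    exact this
  rw [hmax, Ideal.span_singleton_pow, Ideal.mem_span_singleton] at hxa
  obtain ⟨u, rfl⟩ := hxa
  refine ⟨a, u, ?_, rfl⟩
  by_contra hu
  apply hn₀
  have humem : u ∈ maximalIdeal R := (mem_maximalIdeal _).2 (mem_nonunits_iff.2 hu)
  rw [hmax, Ideal.mem_span_singleton] at humem
  obtain ⟨v, rfl⟩ := humem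
  rw [ha, hmax, Ideal.span_singleton_pow, Ideal.mem_span_singleton, pow_succ]
  exact ⟨v, by ring⟩

omit [Fact p.Prime] in
/-- A Noetherian local ring with maximal ideal `pR` on which `p` is a non-zero-divisor is an
integral domain. [cite: Matsumura1987, §29 pp. 223–225] -/
theorem isDomain_of_pRing (hmax : maximalIdeal R = Ideal.span {(p : R)})
    (htf : ∀ r : R, (p : R) * r = 0 → r = 0) : IsDomain R := by
  have hpow : ∀ (a : ℕ) (r : R), (p : R) ^ a * r = 0 → r = 0 := by
    intro a
    induction a with
    | zero => intro r hr; rwa [pow_zero, one_mul] at hr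
    | succ a ih => intro r hr; rw [pow_succ, mul_assoc] at hr; exact htf r (ih _ hr)
  haveI : NoZeroDivisors R := by
    refine ⟨fun {x y} hxy => ?_⟩
    by_contra hcon
    push Not at hcon
    obtain ⟨a, u, hu, rfl⟩ := exists_eq_pow_mul_unit_of_pRing p hmax hcon.1
    obtain ⟨b, v, hv, rfl⟩ := exists_eq_pow_mul_unit_of_pRing p hmax hcon.2
    have h1 : (p : R) ^ (a + b) * (u * v) = 0 := by rw [← hxy]; ring
    have h2 := hpow _ _ h1
    exact (hu.mul hv).ne_zero h2
  exact NoZeroDivisors.to_isDomain R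

omit [IsNoetherianRing R] in
/-- Such a ring is torsion-free over `ℤ`: an integer `n ≠ 0` is `pᵉ n'` with `p ∤ n'`, and `n'`
is a unit of `R` (its residue is non-zero in the characteristic-`p` residue field).
[cite: Matsumura1987, §29 pp. 223–225] -/
theorem isAddTorsionFree_of_pRing (hmax : maximalIdeal R = Ideal.span {(p : R)})
    (htf : ∀ r : R, (p : R) * r = 0 → r = 0) : IsAddTorsionFree R := by
  refine ⟨fun n hn x y hxy => ?_⟩
  dsimp only at hxy
  rw [← sub_eq_zero, ← smul_sub, nsmul_eq_mul] at hxy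
  rw [← sub_eq_zero]
  set z := x - y with hz
  obtain ⟨e, n', hn', rfl⟩ := Nat.exists_eq_pow_mul_and_not_dvd hn p (Nat.Prime.one_lt Fact.out).ne'
  -- `n'` is a unit of `R`
  have hunit : IsUnit ((n' : ℕ) : R) := by
    by_contra hnu
    have hmem : ((n' : ℕ) : R) ∈ maximalIdeal R := (mem_maximalIdeal _).2 (mem_nonunits_iff.2 hnu)
    rw [hmax, Ideal.mem_span_singleton] at hmem
    -- then `p ∣ n'` in the residue field, i.e. `n' = 0` in `R/pR`, whose characteristic is `p`
    haveI : CharP (R ⧸ Ideal.span {(p : R)}) p := by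
      haveI : (Ideal.span {(p : R)}).IsMaximal := hmax ▸ maximalIdeal.isMaximal R
      have h0 : ((p : ℕ) : R ⧸ Ideal.span {(p : R)}) = 0 := by
        rw [← map_natCast (Ideal.Quotient.mk _), Ideal.Quotient.eq_zero_iff_mem]
        exact Ideal.subset_span rfl
      exact (CharP.charP_iff_prime_eq_zero Fact.out).2 h0
    have h0 : ((n' : ℕ) : R ⧸ Ideal.span {(p : R)}) = 0 := by
      rw [← map_natCast (Ideal.Quotient.mk _), Ideal.Quotient.eq_zero_iff_mem, Ideal.mem_span_singleton]
      exact hmem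
    rw [CharP.cast_eq_zero_iff _ p] at h0
    exact hn' h0
  have hpow : ∀ (a : ℕ) (r : R), (p : R) ^ a * r = 0 → r = 0 := by
    intro a
    induction a with
    | zero => intro r hr; rwa [pow_zero, one_mul] at hr
    | succ a ih => intro r hr; rw [pow_succ, mul_assoc] at hr; exact htf r (ih _ hr)
  rw [Nat.cast_mul, Nat.cast_pow, mul_assoc] at hxy
  have h2 := hpow e _ hxy
  exact (hunit.mul_right_eq_zero).1 h2

end PRing

/-! ### The Cohen ring mapping to a complete local ring of residue characteristic `p` -/

/-- **Kato (3.2) (2) / Matsumura Thms. 29.1–29.2.** Let `C` be a complete local ring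
whose residue field `k` has characteristic `p > 0`. There are a complete Noetherian local DOMAIN
`R` with maximal ideal `pR ≠ 0` (a complete DVR in which `p` is a prime element) and a ring
homomorphism `j : R → C` inducing a surjection on residue fields (`C = j(R) + 𝔪_C`).
[cite: Kato1994, (3.2)] [cite: Matsumura1987, Thms. 29.1–29.2] -/
theorem exists_cohenDVR_ringHom (C : Type u) [CommRing C] [IsLocalRing C]
    [IsAdicComplete (maximalIdeal C) C] (p : ℕ) [Fact p.Prime] [CharP (ResidueField C) p] :
    ∃ (R : Type u) (_ : CommRing R) (_ : IsLocalRing R) (_ : IsDomain R),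
      IsNoetherianRing R ∧ IsAdicComplete (maximalIdeal R) R ∧
      maximalIdeal R = Ideal.span {(p : R)} ∧ (p : R) ≠ 0 ∧
      ∃ j : R →+* C, ∀ c : C, ∃ r : R, c - j r ∈ maximalIdeal C := by
  obtain ⟨R, _, _, hN, hc, hmax, htf, ⟨e⟩⟩ := exists_complete_pRing p (ResidueField C)
  haveI := hN
  have hdom : IsDomain R := isDomain_of_pRing p hmax htf
  haveI : IsAddTorsionFree R := isAddTorsionFree_of_pRing p hmax htf
  haveI : Module.Flat ℤ R := inferInstance
  -- the lift `j : R → C` (Matsumura 29.2, via the tree's flat lifting)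
  have hJ : (Ideal.span {((p : ℕ) : ℤ)}).map (algebraMap ℤ R) = Ideal.span {(p : R)} := by
    rw [Ideal.map_span, Set.image_singleton, map_natCast]
  obtain ⟨j, hj⟩ := Literature.AlgebraicGeometry.Resolution.exists_ringHom_lift_of_flat
    (A := C) p ((Ideal.quotEquivOfEq hJ).trans e)
  refine ⟨R, inferInstance, inferInstance, hdom, hN, hc, hmax, ?_, j, fun c => ?_⟩
  · intro hp0
    have : (1 : R) = 0 := htf 1 (by rw [hp0, zero_mul])
    exact one_ne_zero this
  · -- residue surjectivity: `residue (j r) = e (r mod p)` and `e`, `mk` are onto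
    obtain ⟨y, hy⟩ := e.surjective (residue C c)
    obtain ⟨r, hr⟩ := Ideal.Quotient.mk_surjective ((Ideal.quotEquivOfEq hJ).symm y)
    refine ⟨r, ?_⟩
    have hres : residue C (j r) = residue C c := by
      rw [hj, RingEquiv.trans_apply, hr, RingEquiv.apply_symm_apply, hy]
    have h0 : residue C (c - j r) = 0 := by rw [map_sub, hres, sub_self]
    exact (IsLocalRing.residue_eq_zero_iff _).1 h0

/-! ### The coefficient field in residue characteristic zero -/

/-- A local ring whose residue field has characteristic zero is a `ℚ`-algebra: every non-zero
integer is a unit (its residue is non-zero). [folklore] -/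
private theorem isUnit_intCast_of_charZero (C : Type u) [CommRing C] [IsLocalRing C]
    [CharZero (ResidueField C)] {n : ℤ} (hn : n ≠ 0) : IsUnit (n : C) := by
  by_contra h
  have hmem : (n : C) ∈ maximalIdeal C := (mem_maximalIdeal _).2 (mem_nonunits_iff.2 h)
  rw [← IsLocalRing.ker_residue, RingHom.mem_ker, map_intCast] at hmem
  exact hn (Int.cast_eq_zero.1 hmem)

/-- **Kato (3.2) (1) / Matsumura Thm. 28.3 (ii), residue characteristic zero.** A complete local
ring whose residue field has characteristic `0` has a coefficient field: a ring homomorphism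
`σ : k → C` with `residue ∘ σ = id`. [cite: Kato1994, (3.2)] [cite: Matsumura1987, Thm. 28.3 (ii)] -/
theorem exists_coefficientField_of_charZero (C : Type u) [CommRing C] [IsLocalRing C]
    [IsAdicComplete (maximalIdeal C) C] [CharZero (ResidueField C)] :
    ∃ σ : ResidueField C →+* C, ∀ x, residue C (σ x) = x := by
  -- `ℚ → C` by the universal property of the fraction field of `ℤ`
  have hunits : ∀ y : nonZeroDivisors ℤ, IsUnit ((Int.castRingHom C) y) := fun y =>
    isUnit_intCast_of_charZero C (nonZeroDivisors.ne_zero y.2)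
  let f : ℚ →+* C := IsLocalization.lift (M := nonZeroDivisors ℤ) (S := ℚ) hunits
  letI : Algebra ℚ C := f.toAlgebra
  exact exists_ringHom_comp_residue_eq_id C ℚ

end Literature.RingTheory.CompleteLocalRings
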